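import Summits.AtomisticToContinuum.HydrodynamicLimit.Theorems.JParityClosureLocalSecondLawLedgerKernel
import Summits.AtomisticToContinuum.HydrodynamicLimit.Theorems.JParityClosureLocalSecondLawLedgerCalculus
import Mathlib.Analysis.Calculus.FDeriv.Measurable

/-!
# Entropy ledger for `JParityClosure.LocalSecondLaw` — continuous twins of the coarse fields
(stmt-AtomisticToContinuum-13081, line `exact-entropy-ledger-three-passivities`, layer 10 of stub L)

Honesty of the time integrals of the ledger needs the integrands to be measurable in `(s, x)` along the
orbit.  The crux's fields divide by `ρ_r` and `θ_r` and feed `ρ_rσ³` to the excess free energy, so as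
functions of an ARBITRARY configuration they are discontinuous; but on the regular range they coincide with
their *twins* in which `ρ_r` is replaced by `max ρ_r c`, `θ_r` by `max θ_r c` and the equation-of-state argument
by `min (ρ_rσ³) η₁`.  The twins are jointly continuous in (configuration, field point), hence measurable along
the (measurable) orbit, and the crux's partial derivatives of the twins are measurable with the configuration
as a parameter (Mathlib's `measurable_deriv_with_param`).

References: H. Federer, *Geometric Measure Theory* (1969) 2.3 (measurable sections).
-/

noncomputable section

namespace Summit.AtomisticToContinuum.HydrodynamicLimit.Theorems.LocalSecondLawLedger

open scoped BigOperators Topology ENNReal InnerProductSpace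
open Filter Set MeasureTheory
open Literature.MathematicalPhysics.KineticTheory
open Literature.Analysis.FluidPDE
open Literature.Analysis.FunctionSpaces
open Summit.AtomisticToContinuum.HydrodynamicLimit.Theorems.LocalSecondLawNegative

namespace L

variable {N : ℕ}

/-! ## The twins -/

/-- Twin density `max ρ_r c`. [folklore] -/
def rhoT (r c : ℝ) (w : Phase N) (y : T3) : ℝ := max (rhoC r w y) c

/-- Twin temperature `max θ_r c` (computed with the twin density). [folklore] -/
def thetaT (r c : ℝ) (w : Phase N) (y : T3) : ℝ :=
  max (2 / 3 * (kinC r w y / rhoT r c w y - (∑ k, momC r w y k ^ 2) / (2 * rhoT r c w y ^ 2))) c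

/-- Twin coarse velocity. [folklore] -/
def uT (r c : ℝ) (w : Phase N) (y : T3) (l : Fin 3) : ℝ := (rhoT r c w y)⁻¹ * momC r w y l

/-- Twin entropy density (equation-of-state argument clamped into the band). [folklore] -/
def HsT (σ r c η₁ : ℝ) (w : Phase N) (y : T3) : ℝ :=
  -(rhoT r c w y * (3 / 2 * Real.log (thetaT r c w y) - Real.log (rhoT r c w y)
    - hsExcessFreeEnergy (min (rhoT r c w y * σ ^ 3) η₁)))

/-- Twin traceless stress. [folklore] -/
def devT (r c : ℝ) (w : Phase N) (y : T3) (k l : Fin 3) : ℝ :=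
  Mmom r w y k l - uT r c w y k * momC r w y l - momC r w y k * uT r c w y l
    + rhoT r c w y * uT r c w y k * uT r c w y l - rhoT r c w y * thetaT r c w y * (if k = l then 1 else 0)

/-- Twin excess pressure. [folklore] -/
def pexT (σ r c η₁ : ℝ) (w : Phase N) (y : T3) : ℝ :=
  rhoT r c w y * thetaT r c w y * (rhoT r c w y * σ ^ 3 * deriv hsExcessFreeEnergy (min (rhoT r c w y * σ ^ 3) η₁))

/-- Twin kinetic heat current (particle form, coordinates). [folklore] -/
def qT (r c : ℝ) (w : Phase N) (y : T3) (k : Fin 3) : ℝ :=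
  ((N + 1 : ℕ) : ℝ)⁻¹ * ∑ i, cone r (w i).1 y *
    ((∑ l, ((w i).2 l - uT r c w y l) ^ 2) / 2 * ((w i).2 k - uT r c w y k))

/-! ## The twins are the fields on the regular range -/

section RegularEq

variable {σ r c η₁ : ℝ} (hc : 0 < c) {w : Phase N}
  (hreg : ∀ x, c ≤ rhoC r w x ∧ rhoC r w x * σ ^ 3 ≤ η₁ ∧ c ≤ thetaC r w x)
include hreg

/-- On the regular range the twin density is the density. [folklore] -/
theorem rhoT_eq (y : T3) : rhoT r c w y = rhoC r w y := max_eq_left (hreg y).1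

/-- On the regular range the twin temperature is the temperature. [folklore] -/
theorem thetaT_eq (y : T3) : thetaT r c w y = thetaC r w y := by
  unfold thetaT; rw [rhoT_eq hreg, ← thetaC_eq]; exact max_eq_left (hreg y).2.2

/-- On the regular range the twin velocity is the velocity. [folklore] -/
theorem uT_eq (y : T3) (l : Fin 3) : uT r c w y l = uC r w y l := by
  rw [uT, rhoT_eq hreg, uC_apply]

include hc in
/-- On the regular range the twin entropy density is the entropy density. [folklore] -/
theorem HsT_eq (y : T3) : HsT σ r c η₁ w y = Hs σ (rhoC r w y) (thetaC r w y) := by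
  rw [HsT, thetaT_eq hreg, rhoT_eq hreg, min_eq_left (hreg y).2.1,
    Hs_eq_Hsm (hc.trans_le (hreg y).1) (hc.trans_le (hreg y).2.2)]
  rfl

/-- On the regular range the twin traceless stress is the traceless stress. [folklore] -/
theorem devT_eq (y : T3) (k l : Fin 3) : devT r c w y k l = devC r w y k l := by
  rw [devT, devC_eq, thetaT_eq hreg, rhoT_eq hreg, uT_eq hreg, uT_eq hreg]

/-- On the regular range the twin excess pressure is the excess pressure. [folklore] -/
theorem pexT_eq (y : T3) : pexT σ r c η₁ w y = pexC σ r w y := by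
  rw [pexT, thetaT_eq hreg, rhoT_eq hreg, min_eq_left (hreg y).2.1]
  unfold pexC hsPressure hsCompressibility
  ring

omit hreg in
/-- The kinetic heat current in particle form (coordinates). [folklore] -/
theorem qkinC_apply_eq_sum (r : ℝ) (w : Phase N) (y : T3) (k : Fin 3) :
    qkinC r w y k = ((N + 1 : ℕ) : ℝ)⁻¹ * ∑ i, cone r (w i).1 y *
      ((∑ l, ((w i).2 l - uC r w y l) ^ 2) / 2 * ((w i).2 k - uC r w y k)) := by
  unfold qkinC
  rw [integral_empiricalMeasure_vec, PiLp.smul_apply, smul_eq_mul, WithLp.ofLp_sum, Finset.sum_apply]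
  congr 1
  refine Finset.sum_congr rfl fun i _ => ?_
  rw [WithLp.ofLp_smul, Pi.smul_apply, smul_eq_mul, PiLp.sub_apply, mul_assoc, norm_sq_eq_sum]
  rfl

/-- On the regular range the twin heat current is the kinetic heat current. [folklore] -/
theorem qT_eq (y : T3) (k : Fin 3) : qT r c w y k = qkinC r w y k := by
  rw [qT, qkinC_apply_eq_sum]
  simp only [uT_eq hreg]

/-- Function-level version of `uT_eq`. [folklore] -/
theorem uT_fun_eq (l : Fin 3) : (fun y => uT r c w y l) = fun y => uC r w y l := funext fun y => uT_eq hreg y l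

/-- Function-level version of `thetaT_eq`. [folklore] -/
theorem thetaT_fun_eq : thetaT r c w = thetaC r w := funext fun y => thetaT_eq hreg y

end RegularEq

/-! ## Joint continuity in configuration and field point -/

section Continuity

variable {σ r c η₁ η₀ : ℝ} {F : ℝ → ℝ} (hE : EosBand η₀ F) (hη : 0 < η₁) (hη₁ : η₁ < η₀) (hσ : 0 < σ)
  (hr : 0 < r) (hc : 0 < c)

/-- Positions of a fixed particle depend continuously on the configuration. [folklore] -/
theorem continuous_pos₂ (i : Fin (N + 1)) : Continuous fun p : Phase N × T3 => (p.1 i).1 :=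
  continuous_fst.comp ((continuous_apply i).comp continuous_fst)

/-- Velocity components of a fixed particle depend continuously on the configuration. [folklore] -/
theorem continuous_vel₂ (i : Fin (N + 1)) (j : Fin 3) : Continuous fun p : Phase N × T3 => (p.1 i).2 j :=
  (continuous_apply j).comp ((PiLp.continuous_ofLp 2 _).comp (continuous_snd.comp ((continuous_apply i).comp continuous_fst)))

/-- The speed of a fixed particle depends continuously on the configuration. [folklore] -/
theorem continuous_speed₂ (i : Fin (N + 1)) : Continuous fun p : Phase N × T3 => ‖(p.1 i).2‖ :=
  (continuous_snd.comp ((continuous_apply i).comp continuous_fst)).norm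

include hr in
/-- The kernel of a fixed particle is jointly continuous in configuration and field point. [folklore] -/
theorem continuous_cone₂ (i : Fin (N + 1)) : Continuous fun p : Phase N × T3 => cone r (p.1 i).1 p.2 := by
  have : (fun p : Phase N × T3 => cone r (p.1 i).1 p.2) = fun p => cone r ((p.1 i).1 - p.2) 0 :=
    funext fun p => cone_eq_sub _ _ _
  rw [this]
  exact (lipschitzWith_cone_zero hr).continuous.comp ((continuous_pos₂ i).sub continuous_snd)

include hr in
/-- The mollified density is jointly continuous in (configuration, field point). [folklore] -/
theorem continuous_rhoC₂ : Continuous fun p : Phase N × T3 => rhoC r p.1 p.2 := by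
  simp only [rhoC_eq_sum]
  exact continuous_const.mul (continuous_finsetSum _ fun i _ => continuous_cone₂ hr i)

include hr in
/-- The mollified momentum is jointly continuous in (configuration, field point). [folklore] -/
theorem continuous_momC₂ (l : Fin 3) : Continuous fun p : Phase N × T3 => momC r p.1 p.2 l := by
  simp only [momC_apply_eq_sum]
  exact continuous_const.mul (continuous_finsetSum _ fun i _ => (continuous_cone₂ hr i).mul (continuous_vel₂ i l))

include hr in
/-- The mollified kinetic energy is jointly continuous in (configuration, field point). [folklore] -/
theorem continuous_kinC₂ : Continuous fun p : Phase N × T3 => kinC r p.1 p.2 := by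
  simp only [kinC_eq_sum]
  exact continuous_const.mul (continuous_finsetSum _ fun i _ =>
    (continuous_cone₂ hr i).mul (((continuous_speed₂ i).pow 2).div_const 2))

include hr in
/-- The second velocity moment is jointly continuous in (configuration, field point). [folklore] -/
theorem continuous_Mmom₂ (k l : Fin 3) : Continuous fun p : Phase N × T3 => Mmom r p.1 p.2 k l := by
  unfold Mmom
  exact continuous_const.mul (continuous_finsetSum _ fun i _ =>
    (continuous_cone₂ hr i).mul ((continuous_vel₂ i k).mul (continuous_vel₂ i l)))

include hr in
/-- The twin density is jointly continuous. [folklore] -/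
theorem continuous_rhoT₂ : Continuous fun p : Phase N × T3 => rhoT r c p.1 p.2 :=
  (continuous_rhoC₂ hr).max continuous_const

include hc in
/-- The twin density is positive. [folklore] -/
theorem rhoT_pos (w : Phase N) (y : T3) : 0 < rhoT r c w y := hc.trans_le (le_max_right _ _)

include hc in
/-- The twin temperature is positive. [folklore] -/
theorem thetaT_pos (w : Phase N) (y : T3) : 0 < thetaT r c w y := hc.trans_le (le_max_right _ _)

include hr hc in
/-- The twin temperature is jointly continuous. [folklore] -/
theorem continuous_thetaT₂ : Continuous fun p : Phase N × T3 => thetaT r c p.1 p.2 := by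
  unfold thetaT
  have hρ := continuous_rhoT₂ hr (c := c) (N := N)
  have hne : ∀ p : Phase N × T3, rhoT r c p.1 p.2 ≠ 0 := fun p => (rhoT_pos hc p.1 p.2).ne'
  refine (continuous_const.mul (((continuous_kinC₂ hr).div hρ hne).sub ?_)).max continuous_const
  refine (continuous_finsetSum _ fun k _ => (continuous_momC₂ hr k).pow 2).div
    (continuous_const.mul (hρ.pow 2)) fun p => ?_
  exact mul_ne_zero two_ne_zero (pow_ne_zero 2 (hne p))

include hr hc in
/-- The twin velocity is jointly continuous. [folklore] -/
theorem continuous_uT₂ (l : Fin 3) : Continuous fun p : Phase N × T3 => uT r c p.1 p.2 l :=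
  ((continuous_rhoT₂ hr).inv₀ fun p => (rhoT_pos hc p.1 p.2).ne').mul (continuous_momC₂ hr l)

include hη hη₁ hσ hc in
/-- The clamped packing fraction of the twin density lies in the EOS band. [folklore] -/
theorem clampEos_mem (w : Phase N) (y : T3) : min (rhoT r c w y * σ ^ 3) η₁ ∈ Set.Ioo 0 η₀ :=
  ⟨lt_min (mul_pos (rhoT_pos hc w y) (by positivity)) hη, (min_le_right _ _).trans_lt hη₁⟩

include hE hη hη₁ hσ hr hc in
/-- The twin entropy density is jointly continuous. [folklore] -/
theorem continuous_HsT₂ : Continuous fun p : Phase N × T3 => HsT σ r c η₁ p.1 p.2 := by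
  unfold HsT
  have hρ := continuous_rhoT₂ hr (c := c) (N := N)
  have hθ := continuous_thetaT₂ hr hc (N := N)
  have hf : Continuous fun p : Phase N × T3 => hsExcessFreeEnergy (min (rhoT r c p.1 p.2 * σ ^ 3) η₁) :=
    (eos_contDiffOn hE (n := 0)).continuousOn.comp_continuous ((hρ.mul continuous_const).min continuous_const)
      fun p => clampEos_mem hη hη₁ hσ hc p.1 p.2
  exact (hρ.mul (((continuous_const.mul (hθ.log fun p => (thetaT_pos hc p.1 p.2).ne')).sub
    (hρ.log fun p => (rhoT_pos hc p.1 p.2).ne')).sub hf)).neg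

include hr hc in
/-- The twin traceless stress is jointly continuous. [folklore] -/
theorem continuous_devT₂ (k l : Fin 3) : Continuous fun p : Phase N × T3 => devT r c p.1 p.2 k l := by
  unfold devT
  have hρ := continuous_rhoT₂ hr (c := c) (N := N)
  have hθ := continuous_thetaT₂ hr hc (N := N)
  have hu := fun j => continuous_uT₂ hr hc (N := N) j
  have hm := fun j => continuous_momC₂ hr (N := N) j
  exact ((((continuous_Mmom₂ hr k l).sub ((hu k).mul (hm l))).sub ((hm k).mul (hu l))).add
    ((hρ.mul (hu k)).mul (hu l))).sub ((hρ.mul hθ).mul continuous_const)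

include hE hη hη₁ hσ hr hc in
/-- The twin excess pressure is jointly continuous. [folklore] -/
theorem continuous_pexT₂ : Continuous fun p : Phase N × T3 => pexT σ r c η₁ p.1 p.2 := by
  unfold pexT
  have hρ := continuous_rhoT₂ hr (c := c) (N := N)
  have hθ := continuous_thetaT₂ hr hc (N := N)
  have hf : Continuous fun p : Phase N × T3 => deriv hsExcessFreeEnergy (min (rhoT r c p.1 p.2 * σ ^ 3) η₁) :=
    (EosBand.continuousOn_deriv hE).comp_continuous ((hρ.mul continuous_const).min continuous_const)
      fun p => clampEos_mem hη hη₁ hσ hc p.1 p.2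
  exact (hρ.mul hθ).mul (((hρ.mul continuous_const)).mul hf)

include hr hc in
/-- The twin heat current is jointly continuous. [folklore] -/
theorem continuous_qT₂ (k : Fin 3) : Continuous fun p : Phase N × T3 => qT r c p.1 p.2 k := by
  unfold qT
  have hu := fun j => continuous_uT₂ hr hc (N := N) j
  refine continuous_const.mul (continuous_finsetSum _ fun i _ => (continuous_cone₂ hr i).mul ?_)
  exact ((continuous_finsetSum _ fun l _ => ((continuous_vel₂ i l).sub (hu l)).pow 2).div_const 2).mul
    ((continuous_vel₂ i k).sub (hu k))

end Continuity

/-! ## Measurability of the crux's partial derivatives with a parameter -/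

/-- For a jointly continuous family of fields `g a` on `𝕋³`, `(a, x) ↦ ∂ₖ (g a) (x)` is measurable
(Mathlib's `measurable_deriv_with_param`). [folklore] -/
theorem measurable_pD_param {α : Type*} [TopologicalSpace α] [MeasurableSpace α] [OpensMeasurableSpace α]
    {g : α → T3 → ℝ} (hg : Continuous (Function.uncurry g)) (k : Fin 3) :
    Measurable fun p : α × T3 => pD k (g p.1) p.2 := by
  have hc : Continuous (Function.uncurry fun (q : α × T3) (t : ℝ) =>
      g q.1 (q.2 + Torus.proj (t • EuclideanSpace.single k 1))) :=
    hg.comp ((continuous_fst.comp continuous_fst).prodMk ((continuous_snd.comp continuous_fst).add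
      (Torus.continuous_proj.comp (continuous_snd.smul continuous_const))))
  exact (measurable_deriv_with_param hc).comp (measurable_id.prodMk measurable_const)

end L

/-- **Registered sub-goal `ledgerL_twins`** of stub `stub_ledger` (line `exact-entropy-ledger-three-passivities`):
The twin coarse temperature is jointly continuous in configuration and field point. [folklore] -/
theorem ledgerL_twins :
  ∀ {N : ℕ} {r c : ℝ}, 0 < r → 0 < c → Continuous fun p : Phase N × T3 => L.thetaT r c p.1 p.2 :=
  fun hr hc => L.continuous_thetaT₂ hr hc

end Summit.AtomisticToContinuum.HydrodynamicLimit.Theorems.LocalSecondLawLedger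

end
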